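import Summits.BirchSwinnertonDyer.BirchSwinnertonDyer.Theorems.KolyvaginRoadThreeRationalLiftSelmerDescent
import Literature.NumberTheory.EllipticCurves.Skinner2016.SelmerCorankOfVanishingLValue
import Literature.NumberTheory.EllipticCurves.AnomalousOfRationalTorsionProofs
import Literature.NumberTheory.EllipticCurves.SelmerCorankAssembly
import Literature.NumberTheory.EllipticCurves.TamagawaFiniteIndexProofs
import HarnessLib

/-!
# Route `KolyvaginRoadThree`, crux `ZhangSharpFrameAtThreeHL` (item stmt-BirchSwinnertonDyer-19574), stub S1 on RATIONAL lifts: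
# W. Zhang's Thm 7.1 for a RATIONAL raised curve at `p = 3` — the rank-`0` UNIT VALUES over `ℚ` from `Sel₃(E′/K) = 0`,
# by Skinner 2016 Thm. C (1)+(2) BY NAME (cell `bsd-stepL`, seat `bsd-stepL-koly3b` g9)

W. Zhang, Camb. J. Math. 2 (2014), Thm. 7.1 (p. 231): for the level-raised form `g` with `Sel_𝔭(A_g/K) = 0`,
`L(g/K, 1) ≠ 0` and the `𝔭`-part of the BSD formula for `A_g/K` holds — proved from [SU] Thm. 2 for `A` and
its `K`-twist over `ℚ` (+ Kato, + Gross–Zagier-free rank considerations). On a RATIONAL lift `A_g = E′`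
(an elliptic curve over `ℚ`, conductor `N q`, `3 ∥ N`) at `p = 3` the printed inputs are Skinner, Pacific
J. Math. 283 (2016), Thm. C, clause (2) (corank `0 ⇒ L(E,1) ≠ 0`) and clause (1) (the `p`-part in analytic
rank `0`), stated in the tree for every `p ≥ 3` at a good-ordinary OR MULTIPLICATIVE `p` under (irr) + (ram):
`Skinner2016.thmC_one_le_selmerCorank_of_L_one_eq_zero` and `Skinner2016.thmC_padicValRat_bsd_rank_zero`
(= route binder `SkinnerRankZeroPPart`, item 19381; flag `SU14-12.3.6-mu@nonsplit@3` travels with both).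

This file proves, FACT-FREE except for those NAMED facts taken as hypotheses (theorems only):

* §1 `sha_eq_zero_of_selmerGroupPInfty_eq_bot_of_nsmul`, `not_dvd_shaOrder_of_selmerGroupPInfty_eq_bot`,
  `padicValNat_shaOrder_eq_zero_of_selmerGroupPInfty_eq_bot` — `Sel_{p^∞}(E/F) = 0 ⟹ Ш(E/F)[p] = 0 ⟹ p ∤ #Ш`
  (finite `Ш`; tree `exists_mem_selmerGroupPInfty_primaryH1ToH1_eq`, Cauchy);
  `padicValNat_torsionOrder_eq_zero_of_hasIrreducibleModPGaloisRep` — (irr) `⟹ p ∤ #E(ℚ)_tors`.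
* §2 `unitValue_of_selmerGroupPInfty_eq_bot` — ONE curve `X/ℚ` (globally minimal model) at `p ≥ 3`
  good-ordinary-or-multiplicative with (irr) + (ram): `Sel_{p^∞}(X/ℚ) = 0 ⟹ L(X,1) ≠ 0`, `Ш(X/ℚ)` finite and
  `L(X,1)/Ω_X = r ∈ ℚ` with `ord_p r = ord_p ∏_ℓ c_ℓ(X)` (Skinner C (2), then GZK finiteness BY NAME
  `rank_eq_analyticRank_of_analyticRank_le_one` = binder `RankEqAnalyticRankLeOne`, then Skinner C (1) with
  `ord_p #Ш = 0 = ord_p #X(ℚ)_tors`).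
* §3 `unitValues_of_selmerGroup_baseChange_eq_bot` — the PAIR `(E′, E′^{(d_K)})` from the `K`-statement
  `Sel^{(3)}(E′/K) = 0` (GP2@3-RATIONAL currency) through the odd-`p` quadratic descent of
  `KolyvaginRoadThreeRationalLiftSelmerDescent` (koly3b g9): both central values are non-zero and both
  algebraic parts are `3`-adically the Tamagawa products. This is Zhang's Thm. 7.1 for rational lifts at `3`
  read over `ℚ`, modulo the named binders.

HONEST FRAMING. No Gross formula, no period comparison here (that is the (GZcomp) hypothesis of the
companion file `KolyvaginRoadThreeRationalLiftGrossValue.lean`); nothing is booked; closes nothing (T7);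
the two Skinner facts are REFEREED print for `3 ≤ p` with the cell's `@3` proof-input flag (module docstring
of `Skinner2016/RankZeroPPart.lean`). PARTITION: O2@3 (B10) × A1 × crux 19574 × stub S1, brick R7 (E′-side,
rank-`0` converse + `p`-part over `ℚ` ×2) — proves-glue.

References: [cite: WZhang2014, Thm. 7.1] [cite: Skinner2016PacificMC, Thm. C (§1), footnote 1, §2.5]
[cite: SilvermanAEC2009, Thm X.4.2] [cite: Greenberg1999LNM, §1 p. 54] [cite: Mazur1977, Ch. III §5, p. 157].
-/

noncomputable section

open scoped Classical

namespace Summit.BirchSwinnertonDyer.Rank1Residual.X11b.Three.Koly.RationalLift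

open WeierstrassCurve Literature.NumberTheory.EllipticCurves

/-! ## §1 `Sel_{p^∞} = 0 ⟹ p ∤ #Ш`; (irr) `⟹ p ∤ #E(ℚ)_tors` -/

section ShaTorsion

variable {F : Type} [Field F] [NumberField F] (X : WeierstrassCurve F) [X.IsElliptic] (p : ℕ) [Fact p.Prime]

/-- **`Sel_{p^∞}(E/F) = 0 ⟹ Ш(E/F)[p] = 0`**: a `p`-torsion class of `Ш` is the image of a `p`-torsion class
of `Sel_{p^∞}` (tree `exists_mem_selmerGroupPInfty_primaryH1ToH1_eq`, Greenberg's
`0 → E(F) ⊗ ℚ_p/ℤ_p → Sel_{p^∞} → Ш[p^∞] → 0`). [cite: Greenberg1999LNM, §1 p. 54, §2 p. 63] -/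
theorem sha_eq_zero_of_selmerGroupPInfty_eq_bot_of_nsmul (h : selmerGroupPInfty X p = ⊥)
    {s : X.galH1} (hs : s ∈ X.sha) (hps : p • s = 0) : s = 0 := by
  obtain ⟨x, hx, -, rfl⟩ :=
    X.exists_mem_selmerGroupPInfty_primaryH1ToH1_eq p X.zsmul_geomPoints_surjective_holds hs hps
  rw [h, AddSubgroup.mem_bot] at hx
  rw [hx, map_zero]

/-- **`Sel_{p^∞}(E/F) = 0 ⟹ p ∤ #Ш(E/F)`** (for finite `Ш`): otherwise Cauchy's theorem gives a class of
order exactly `p` in `Ш`, which `sha_eq_zero_of_selmerGroupPInfty_eq_bot_of_nsmul` kills.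
[cite: Greenberg1999LNM, §1 p. 54] -/
theorem not_dvd_shaOrder_of_selmerGroupPInfty_eq_bot [Finite X.sha] (h : selmerGroupPInfty X p = ⊥) :
    ¬ p ∣ X.shaOrder := by
  intro hdvd
  obtain ⟨s, hsord⟩ := exists_prime_addOrderOf_dvd_card' (G := X.sha) p hdvd
  have hps : p • (s : X.galH1) = 0 := by
    rw [← AddSubmonoidClass.coe_nsmul, ← hsord, addOrderOf_nsmul_eq_zero, ZeroMemClass.coe_zero]
  have hs0 : (s : X.galH1) = 0 := sha_eq_zero_of_selmerGroupPInfty_eq_bot_of_nsmul X p h s.2 hps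
  have : addOrderOf s = 1 := by
    rw [AddMonoid.addOrderOf_eq_one_iff]
    exact Subtype.ext hs0
  rw [this] at hsord
  exact (Fact.out : p.Prime).one_lt.ne hsord

/-- **`Sel_{p^∞}(E/F) = 0 ⟹ ord_p #Ш(E/F) = 0`** (finite `Ш`). [cite: Greenberg1999LNM, §1 p. 54] -/
theorem padicValNat_shaOrder_eq_zero_of_selmerGroupPInfty_eq_bot [Finite X.sha]
    (h : selmerGroupPInfty X p = ⊥) : padicValNat p X.shaOrder = 0 :=
  padicValNat.eq_zero_of_not_dvd (not_dvd_shaOrder_of_selmerGroupPInfty_eq_bot X p h)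

/-- **(irr) `⟹ ord_p #E(ℚ)_tors = 0`**: a rational point of order `p` spans a `Γ_ℚ`-stable line of `E[p]`
(Mazur 1977 p. 157; tree `not_hasIrreducibleModPGaloisRep_of_dvd_torsionOrder`). [cite: Mazur1977, Ch. III §5, p. 157] -/
theorem padicValNat_torsionOrder_eq_zero_of_hasIrreducibleModPGaloisRep (Y : WeierstrassCurve ℚ) [Y.IsElliptic]
    (hirr : Y.HasIrreducibleModPGaloisRep p) : padicValNat p Y.torsionOrder = 0 :=
  padicValNat.eq_zero_of_not_dvd fun h ↦ not_hasIrreducibleModPGaloisRep_of_dvd_torsionOrder Y p h hirr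

end ShaTorsion

/-! ## §2 One curve over `ℚ`: `Sel_{p^∞}(X/ℚ) = 0 ⟹ L(X,1) ≠ 0` and `ord_p (L(X,1)/Ω_X) = ord_p ∏ c_ℓ` (Skinner C BY NAME) -/

section OneCurve

variable (X : WeierstrassCurve ℚ) [X.IsElliptic] [X.IsGloballyMinimal] (p : ℕ) [Fact p.Prime]

/-- **The rank-`0` unit value of ONE curve over `ℚ` from `Sel_{p^∞} = 0`, by Skinner 2016 Thm. C BY NAME.**
`X/ℚ` globally minimal, `p ≥ 3` good ordinary or multiplicative, (irr) `E[p]` irreducible, (ram) a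
multiplicative `ℓ ≠ p` with `p ∤ ord_ℓ(Δ)`; named facts: clause (2) `hC2`, clause (1) `hC` (= binder
`SkinnerRankZeroPPart`) and Gross–Zagier–Kolyvagin finiteness `hGZK` (= binder `RankEqAnalyticRankLeOne`).
If `Sel_{p^∞}(X/ℚ) = 0` then: `L(X,1) ≠ 0` (clause (2): corank `0`), `Ш(X/ℚ)` is finite (analytic rank `0`),
and `L(X,1)/Ω_X = r ∈ ℚ` with `ord_p r = ord_p ∏_ℓ c_ℓ(X)` (clause (1), with `ord_p #Ш = 0` since
`Ш[p] = 0` and `ord_p #X(ℚ)_tors = 0` by (irr)). [cite: Skinner2016PacificMC, Thm. C (§1) clauses (1), (2)]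
[cite: WZhang2014, Thm. 7.1 (proof)] -/
theorem unitValue_of_selmerGroupPInfty_eq_bot
    (hC2 : Skinner2016.thmC_one_le_selmerCorank_of_L_one_eq_zero)
    (hC : Skinner2016.thmC_padicValRat_bsd_rank_zero)
    (hGZK : rank_eq_analyticRank_of_analyticRank_le_one)
    (hp : 3 ≤ p)
    (hred : (X.HasGoodReductionAtPrime p ∧ ¬ (p : ℤ) ∣ X.frobeniusTrace p) ∨
      X.HasMultiplicativeReductionAtPrime p)
    (hirr : X.HasIrreducibleModPGaloisRep p)
    (hram : ∃ ℓ : ℕ, ∃ _ : Fact ℓ.Prime, ℓ ≠ p ∧ X.HasMultiplicativeReductionAtPrime ℓ ∧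
      ¬ p ∣ padicValInt ℓ X.minimalDiscriminantInt)
    (hSel : selmerGroupPInfty X p = ⊥) :
    X.entireLFunction 1 ≠ 0 ∧ Finite X.sha ∧
      ∃ r : ℚ, X.entireLFunction 1 / (X.realPeriodRat : ℂ) = (r : ℂ) ∧ r ≠ 0 ∧
        padicValRat p r = padicValNat p X.tamagawaProduct := by
  have h0 : X.selmerCorank p = 0 := selmerCorank_eq_zero_of_selmerGroupPInfty_eq_bot X p hSel
  have hL : X.entireLFunction 1 ≠ 0 :=
    Skinner2016.entireLFunction_one_ne_zero_of_selmerCorank_eq_zero_of_thmC hC2 X p hp hred hirr hram h0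
  have hrk : X.analyticRank = 0 :=
    Skinner2016.analyticRank_eq_zero_of_selmerCorank_eq_zero_of_thmC hC2 X p hp hred hirr hram h0
  have hfin : Finite X.sha := (hGZK X (by rw [hrk]; exact zero_le_one)).2
  haveI := hfin
  obtain ⟨r, hr, hval⟩ := hC X p hp hred hirr hram hL hfin
  have hsha : padicValNat p X.shaOrder = 0 := padicValNat_shaOrder_eq_zero_of_selmerGroupPInfty_eq_bot X p hSel
  have htor : padicValNat p X.torsionOrder = 0 :=
    padicValNat_torsionOrder_eq_zero_of_hasIrreducibleModPGaloisRep p X hirr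
  refine ⟨hL, hfin, r, hr, ?_, ?_⟩
  · rintro rfl
    apply hL
    have hΩ : (X.realPeriodRat : ℂ) ≠ 0 := by exact_mod_cast X.realPeriodRat_pos_holds.ne'
    rw [Rat.cast_zero, div_eq_zero_iff] at hr
    exact hr.resolve_right hΩ
  · rw [hval, hsha, htor]
    push_cast
    ring

end OneCurve

/-! ## §3 The pair `(E′, E′^{(d_K)})` from `Sel^{(3)}(E′/K) = 0` — W. Zhang's Thm 7.1 for a RATIONAL lift at `3`, over `ℚ` -/

section Pair

/-- Transport of `Sel^{(n)} = 0` along an equality of levels `n = m` (the crux files write the level as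
`3 ^ 1`, the descent lemmas as `3`). [folklore] -/
theorem selmerGroup_eq_bot_congr {F : Type} [Field F] [NumberField F] (X : WeierstrassCurve F) {n m : ℤ}
    (h : n = m) : selmerGroup X n = ⊥ ↔ selmerGroup X m = ⊥ := by
  subst h
  exact Iff.rfl

variable (W' : WeierstrassCurve ℚ) [W'.IsElliptic] [W'.IsGloballyMinimal]
  (K : Type) [Field K] [NumberField K]
  (Wd : WeierstrassCurve ℚ) [Wd.IsElliptic] [Wd.IsGloballyMinimal]

/-- **W. Zhang's Thm. 7.1 for a RATIONAL level-raised curve at `p = 3`, read over `ℚ` (modulo Skinner C (1)+(2)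
and GZK finiteness BY NAME).** `E′ = W′/ℚ` globally minimal, `K/ℚ` quadratic, `Wd` a globally minimal model of
the twist `E′^{(d_K)}` (`C • W′^{(d_K)} = Wd`); at `3`: both curves good-ordinary-or-multiplicative, (irr), (ram).
If `Sel^{(3)}(E′/K) = 0` (the OUTPUT of GP2@3-RATIONAL at a killing prime, koly3b g7/g8) then
`L(E′,1) ≠ 0`, `L(E′^{(d_K)},1) ≠ 0`, both `Ш` are finite, and the algebraic parts `r = L(E′,1)/Ω_{E′}`,
`r_d = L(Wd,1)/Ω_{Wd}` are non-zero rationals with `ord₃ r = ord₃ ∏ c_ℓ(E′)`, `ord₃ r_d = ord₃ ∏ c_ℓ(Wd)`.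
Road: odd-`p` quadratic Selmer descent (`selmerCorank_rat_and_twist_eq_zero_of_selmerGroup_baseChange_eq_bot`)
then `unitValue_of_selmerGroupPInfty_eq_bot` twice. (Artin: `L(E′/K, s) = L(E′, s) L(E′^{(d_K)}, s)`, so this is
"`L(g/K,1) ≠ 0` and the `𝔭`-part of BSD for `A_g` and `A_g^K`" of the printed Thm. 7.1.)
[cite: WZhang2014, Thm. 7.1] [cite: Skinner2016PacificMC, Thm. C (§1) clauses (1), (2)] -/
theorem unitValues_of_selmerGroup_baseChange_eq_bot
    (hC2 : Skinner2016.thmC_one_le_selmerCorank_of_L_one_eq_zero)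
    (hC : Skinner2016.thmC_padicValRat_bsd_rank_zero)
    (hGZK : rank_eq_analyticRank_of_analyticRank_le_one)
    (h2 : Module.finrank ℚ K = 2) (C : VariableChange ℚ)
    (hCd : C • W'.quadraticTwist (NumberField.discr K : ℚ) = Wd)
    (hred : (W'.HasGoodReductionAtPrime 3 ∧ ¬ (3 : ℤ) ∣ W'.frobeniusTrace 3) ∨
      W'.HasMultiplicativeReductionAtPrime 3)
    (hirr : W'.HasIrreducibleModPGaloisRep 3)
    (hram : ∃ ℓ : ℕ, ∃ _ : Fact ℓ.Prime, ℓ ≠ 3 ∧ W'.HasMultiplicativeReductionAtPrime ℓ ∧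
      ¬ 3 ∣ padicValInt ℓ W'.minimalDiscriminantInt)
    (hred_d : (Wd.HasGoodReductionAtPrime 3 ∧ ¬ (3 : ℤ) ∣ Wd.frobeniusTrace 3) ∨
      Wd.HasMultiplicativeReductionAtPrime 3)
    (hirr_d : Wd.HasIrreducibleModPGaloisRep 3)
    (hram_d : ∃ ℓ : ℕ, ∃ _ : Fact ℓ.Prime, ℓ ≠ 3 ∧ Wd.HasMultiplicativeReductionAtPrime ℓ ∧
      ¬ 3 ∣ padicValInt ℓ Wd.minimalDiscriminantInt)
    (hSel : selmerGroup (W'.baseChange K) ((3 ^ 1 : ℕ) : ℤ) = ⊥) :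
    W'.entireLFunction 1 ≠ 0 ∧ Wd.entireLFunction 1 ≠ 0 ∧ Finite W'.sha ∧ Finite Wd.sha ∧
      ∃ r rd : ℚ, W'.entireLFunction 1 / (W'.realPeriodRat : ℂ) = (r : ℂ) ∧
        Wd.entireLFunction 1 / (Wd.realPeriodRat : ℂ) = (rd : ℂ) ∧ r ≠ 0 ∧ rd ≠ 0 ∧
        padicValRat 3 r = padicValNat 3 W'.tamagawaProduct ∧
        padicValRat 3 rd = padicValNat 3 Wd.tamagawaProduct := by
  have hSel' : selmerGroup (W'.baseChange K) ((3 : ℕ) : ℤ) = ⊥ :=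
    (selmerGroup_eq_bot_congr (W'.baseChange K) (by norm_num : ((3 ^ 1 : ℕ) : ℤ) = ((3 : ℕ) : ℤ))).mp hSel
  obtain ⟨hS, hSd, -, -⟩ := selmerCorank_rat_and_twist_eq_zero_of_selmerGroup_baseChange_eq_bot
    W' K 3 h2 (by norm_num) hSel' Wd C hCd
  obtain ⟨hL, hfin, r, hr, hr0, hvr⟩ :=
    unitValue_of_selmerGroupPInfty_eq_bot W' 3 hC2 hC hGZK le_rfl hred hirr hram hS
  obtain ⟨hLd, hfind, rd, hrd, hrd0, hvrd⟩ :=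
    unitValue_of_selmerGroupPInfty_eq_bot Wd 3 hC2 hC hGZK le_rfl hred_d hirr_d hram_d hSd
  exact ⟨hL, hLd, hfin, hfind, r, rd, hr, hrd, hr0, hrd0, hvr, hvrd⟩

end Pair

end Summit.BirchSwinnertonDyer.Rank1Residual.X11b.Three.Koly.RationalLift

end
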